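import Literature.NumberTheory.Automorphic.BianchiOrdinaryClassicality
import Literature.NumberTheory.Automorphic.HidaTowerDiamondContinuity
import HarnessLib

/-!
# Towards Hida's control theorem for a dominant ordinary point: the diamond character of a
# continuous dominant point is EXACTLY algebraic near the identity

Topic `NumberTheory/Automorphic`; namespace `Literature.NumberTheory.Automorphic`, grouping
sub-namespace `BigHeckeGLn.TameLevel` (dot notation on the predicate `HasDominantDiamondWeight` of
`BianchiOrdinaryClassicality`).  Proof file (theorems only: no definition, no named fact, no
instance) under the named fact `Literature.NumberTheory.Automorphic.hidaControl_dominantOrdinaryPoint`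
(`BianchiOrdinaryClassicality`, unproved: Hida's control theorem in consequence form for `GL₂` over
an imaginary quadratic field): it proves the FIRST STEP of the printed proof in the tree's
vocabulary.  (The sibling `BianchiOrdinaryClassicalityProofs` serves the other named fact of that
file, `bianchi_interiorEigenclass_isCuspidal`.)

In Hida's proof of the control theorem ([Hida1994AIF, §1 p. 1293 and §3, Thm. 3.2]) a `ℚ̄_p`-point
`x` of the (nearly) ordinary big Hecke algebra `h^{n.ord}(S)` is first restricted to the torus
`G = T(𝒪_{F,p})/Ē` (through the diamond operators), giving a continuous character `κ_x`, and the
theorem is applied at the ARITHMETIC character `κ_x`: "We call a character `κ` of the compact group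
`G_S` arithmetic if its restriction to an open neighborhood of the identity coincides with an
element of `X(G_S)`" (loc. cit., p. 1293); `P_κ = ker(κ : 𝒪[[G]] → ℚ̄_p)` is then the prime at
which `h^{n.ord}(S)/P_κ h^{n.ord}(S) → h_κ^{n.ord}(S₀(p^α); 𝒪)` has finite kernel and cokernel
(Thm. 3.2).  The tree's hypothesis `TameLevel.HasDominantDiamondWeight 𝒰 x k` only records the
algebraic character `diag(t₀, t₁) ↦ N(t₁)^{2−k}` UP TO `N`-TH POWERS on the (dense) global
`p`-units; this file proves that for a CONTINUOUS point this already forces EXACT agreement on a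
neighbourhood of the identity:

* `TameLevel.HasDominantDiamondWeight.exists_forall_eq`: for `𝒰` maximal above `p`, `x` continuous
  and `HasDominantDiamondWeight 𝒰 x k`, there is `c` such that for every global `u ∈ 𝓞 F` with
  `u ≡ 1 (mod p^c)` (and its local unit images `û_v`, `v ∣ p`)
  `∏_{v ∣ p} x(⟨diag(1, û_v)⟩_v) = N_{F/ℚ}(u)^{2−k}` and `∏_{v ∣ p} x(⟨diag(û_v, 1)⟩_v) = 1` — i.e.
  `κ_x` IS the arithmetic character of parallel weight `k` (`n(κ) = k − 2`, `v(κ) = 0`) with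
  nebentype of conductor dividing `p^c`, the input of [Hida1994AIF, Thm. 3.2] /
  [KhareThorne2017, Cor. 6.15 (℘_𝛌)].

Ingredients (all proved here or in the tree): the diamond operator of a unit `≡ 1 (mod ϖ_v^B)` is
the identity on every `H^i(X_{U(r)}, ℤ/p^s)` with `r ≤ B`, so `x(⟨r_B⟩_v) → 1` for a continuous `x`
(`tendsto_apply_ordDiamond`, file `HidaTowerDiamondContinuity`); `N_{F/ℚ}(1 + p^c w) ≡ 1 (mod p^c)`
(`dvd_norm_one_add_smul_sub_one`: the left-multiplication matrix is `≡ 1`, determinants commute with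
reduction); hence both sides tend to `1` `p`-adically along `u → 1`, their ratio is an `N`-th root
of unity tending to `1`, and the `N`-th roots of unity form a finite, hence discrete, set
(`eventually_eq_one_of_pow_eq_one`).

## References

* H. Hida, *p-adic ordinary Hecke algebras for GL(2)*, Ann. Inst. Fourier 44 (1994), §1 p. 1293
  (arithmetic characters `A(G_S)`), Thm. 3.2 (held; read 2026-08-16). [Hida1994AIF]
* C. Khare, J. A. Thorne, *Potential automorphy and the Leopoldt conjecture*, Amer. J. Math. 139
  (2017), §6.4 Cor. 6.15, §6.5 Lemma 6.17 (arXiv:1409.7007, held; read 2026-08-16).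
  [KhareThorne2017]
-/

noncomputable section

open scoped NumberField
open IsDedekindDomain Filter Topology

namespace Literature.NumberTheory.Automorphic

/-! ### Two elementary lemmas -/

/-- **A net of `N`-th roots of unity converging to `1` is eventually equal to `1`**: the `N`-th
roots of unity in a domain form a finite set, closed in a `T₁` topology, so `1` has a neighbourhood
containing no other `N`-th root of unity. [folklore] -/
theorem eventually_eq_one_of_pow_eq_one {K : Type*} [CommRing K] [IsDomain K] [TopologicalSpace K]
    [T1Space K] {ι : Type*} {l : Filter ι} {f : ι → K} {N : ℕ} (hN : 0 < N)
    (hf : ∀ i, f i ^ N = 1) (h : Tendsto f l (𝓝 1)) : ∀ᶠ i in l, f i = 1 := by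
  classical
  set S : Set K := ((Polynomial.nthRoots N (1 : K)).toFinset : Set K) \ {1} with hS
  have hSfin : S.Finite := (Finset.finite_toSet _).sdiff
  have hopen : IsOpen Sᶜ := hSfin.isClosed.isOpen_compl
  have h1 : (1 : K) ∈ Sᶜ := fun h1 => h1.2 rfl
  filter_upwards [h (hopen.mem_nhds h1)] with i hi
  by_contra hne
  refine hi ⟨?_, hne⟩
  rw [Finset.mem_coe, Multiset.mem_toFinset, Polynomial.mem_nthRoots hN]
  exact hf i

/-- **`N_{S/R}(1 + r w) ≡ 1 (mod r)`** for a finite free algebra `S/R`: the left-multiplication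
matrix of `1 + r w` reduces to `1` modulo `r`, and the determinant commutes with reduction.
[folklore] -/
theorem dvd_norm_one_add_smul_sub_one {R S : Type*} [CommRing R] [CommRing S] [Algebra R S]
    [Module.Free R S] [Module.Finite R S] (r : R) (w : S) :
    r ∣ Algebra.norm R (1 + r • w) - 1 := by
  classical
  let b := Module.Free.chooseBasis R S
  rw [Algebra.norm_eq_matrix_det b, map_add, map_one, map_smul, ← Ideal.mem_span_singleton,
    ← Ideal.Quotient.eq_zero_iff_mem, map_sub, map_one, RingHom.map_det, sub_eq_zero]
  have hmat : (Ideal.Quotient.mk (Ideal.span {r})).mapMatrix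
      (1 + r • Algebra.leftMulMatrix b w) = 1 := by
    ext i j
    have hr : Ideal.Quotient.mk (Ideal.span {r}) r = 0 :=
      Ideal.Quotient.eq_zero_iff_mem.2 (Ideal.mem_span_singleton_self r)
    simp [Matrix.one_apply, hr]
  rw [hmat, Matrix.det_one]

/-! ### The diamond character of a continuous dominant point -/

namespace BigHeckeGLn.TameLevel

variable {F : Type} [Field F] [NumberField F] {p : ℕ} [Fact p.Prime] {𝒰 : TameLevel 2 F p}
  {x : OrdinaryHeckeAlgebraGLn 𝒰 →+* PadicAlgCl p} {k : ℕ}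

omit [Fact p.Prime] in
/-- For `u ∈ 𝓞 F` with `p^c ∣ u - 1` and a place `v ∋ p`, the image of `u` in `F_v` is within
`exp(-c)` of `1`. [folklore] -/
theorem valued_algebraMap_sub_one_le {u : 𝓞 F} {c : ℕ} (hu : (p : 𝓞 F) ^ c ∣ u - 1)
    {v : HeightOneSpectrum (𝓞 F)} (hv : (p : 𝓞 F) ∈ v.asIdeal) :
    Valued.v (algebraMap F (v.adicCompletion F) (u : F) - 1) ≤ WithZero.exp (-(c : ℤ)) := by
  have hmem : u - 1 ∈ v.asIdeal ^ c := by
    obtain ⟨w, hw⟩ := hu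
    rw [hw]
    exact Ideal.mul_mem_right _ _ (Ideal.pow_mem_pow hv c)
  have h1 : ((u : F)) - 1 = ((u - 1 : 𝓞 F) : F) := by push_cast; ring
  rw [← map_one (algebraMap F (v.adicCompletion F)), ← map_sub, h1,
    NumberField.RingOfIntegers.coe_eq_algebraMap]
  change Valued.v ((algebraMap (𝓞 F) F (u - 1) : v.adicCompletion F)) ≤ _
  rw [HeightOneSpectrum.valuedAdicCompletion_eq_valuation', HeightOneSpectrum.valuation_of_algebraMap]
  exact (v.intValuation_le_pow_iff_mem _ c).2 hmem

/-- **The diamond character of a continuous dominant point is exactly algebraic near `1`**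
(first step of the control theorem: `κ_x` is ARITHMETIC of parallel weight `k`).  For `𝒰` maximal
above `p`, a continuous `x : 𝕋^{S,ord}(𝒰) → ℚ̄_p` and `HasDominantDiamondWeight 𝒰 x k`, there is
`c` such that for all `u ∈ 𝓞 F` with `u ≡ 1 (mod p^c)` and local unit images `û_v` (`v ∣ p`):
`∏_{v ∣ p} x(⟨diag(1, û_v)⟩_v) = N_{F/ℚ}(u)^{2-k}` and `∏_{v ∣ p} x(⟨diag(û_v, 1)⟩_v) = 1`.
Proof: along any sequence `u_c ≡ 1 (mod p^c)` both products and `N(u_c)^{2-k}` tend to `1`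
(`tendsto_apply_ordDiamond`; `N(u_c) ≡ 1 (mod p^c)`), the ratios are `N`-th roots of unity, hence
eventually `1` (`eventually_eq_one_of_pow_eq_one`).
[cite: Hida1994AIF, §1 p. 1293 (arithmetic characters) and Thm. 3.2]
[cite: KhareThorne2017, §6.4 Cor. 6.15] -/
theorem HasDominantDiamondWeight.exists_forall_eq (h𝒰 : 𝒰.IsMaximalAbove) (hx : Continuous x)
    (h : 𝒰.HasDominantDiamondWeight x k) :
    ∃ c : ℕ, ∀ (u : 𝓞 F)
      (û : ∀ v : HeightOneSpectrum (𝓞 F), (p : 𝓞 F) ∈ v.asIdeal → (v.adicCompletionIntegers F)ˣ),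
      (∀ (v : HeightOneSpectrum (𝓞 F)) (hv : (p : 𝓞 F) ∈ v.asIdeal),
          ((û v hv : v.adicCompletionIntegers F) : v.adicCompletion F) =
            algebraMap F (v.adicCompletion F) (u : F)) →
      (p : 𝓞 F) ^ c ∣ u - 1 →
      (∏ᶠ v : {v : HeightOneSpectrum (𝓞 F) // (p : 𝓞 F) ∈ v.asIdeal},
          x (𝒰.ordDiamond v.2 (Pi.mulSingle (1 : Fin 2) (û v.1 v.2)))) =
        ((Algebra.norm ℤ u : ℤ) : PadicAlgCl p) ^ (2 - (k : ℤ)) ∧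
      (∏ᶠ v : {v : HeightOneSpectrum (𝓞 F) // (p : 𝓞 F) ∈ v.asIdeal},
          x (𝒰.ordDiamond v.2 (Pi.mulSingle (0 : Fin 2) (û v.1 v.2)))) = 1 := by
  classical
  obtain ⟨N, hN, hNu⟩ := h
  by_contra hcon
  push Not at hcon
  choose u û hcompat hdiv hfail using hcon
  -- notation for the three quantities along the sequence `c ↦ (u c, û c)`
  haveI : Fintype {v : HeightOneSpectrum (𝓞 F) // (p : 𝓞 F) ∈ v.asIdeal} :=
    (finite_setOf_natCast_mem_asIdeal F p).fintype
  set A : ℕ → PadicAlgCl p := fun c =>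
    ∏ᶠ v : {v : HeightOneSpectrum (𝓞 F) // (p : 𝓞 F) ∈ v.asIdeal},
      x (𝒰.ordDiamond v.2 (Pi.mulSingle (1 : Fin 2) (û c v.1 v.2))) with hA
  set B : ℕ → PadicAlgCl p := fun c =>
    ((Algebra.norm ℤ (u c) : ℤ) : PadicAlgCl p) ^ (2 - (k : ℤ)) with hB
  set C : ℕ → PadicAlgCl p := fun c =>
    ∏ᶠ v : {v : HeightOneSpectrum (𝓞 F) // (p : 𝓞 F) ∈ v.asIdeal},
      x (𝒰.ordDiamond v.2 (Pi.mulSingle (0 : Fin 2) (û c v.1 v.2))) with hC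
  have hpow : ∀ c, A c ^ N = B c ^ N ∧ C c ^ N = 1 := fun c => hNu (u c) (û c) (hcompat c)
  -- (1) every diamond factor tends to `1`
  have hval : ∀ (c : ℕ) (v : HeightOneSpectrum (𝓞 F)) (hv : (p : 𝓞 F) ∈ v.asIdeal),
      Valued.v (((û c v hv : v.adicCompletionIntegers F) : v.adicCompletion F) - 1) ≤
        WithZero.exp (-(c : ℤ)) := fun c v hv => by
    rw [hcompat c v hv]
    exact valued_algebraMap_sub_one_le (hdiv c) hv
  have hfactor : ∀ (i : Fin 2) (v : {v : HeightOneSpectrum (𝓞 F) // (p : 𝓞 F) ∈ v.asIdeal}),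
      Tendsto (fun c => x (𝒰.ordDiamond v.2 (Pi.mulSingle i (û c v.1 v.2)))) atTop (𝓝 1) := by
    intro i v
    refine tendsto_apply_ordDiamond x hx h𝒰 v.2 (fun c => Pi.mulSingle i (û c v.1 v.2)) fun c j => ?_
    by_cases hj : j = i
    · subst hj
      rw [Pi.mulSingle_eq_same]
      exact hval c v.1 v.2
    · rw [Pi.mulSingle_eq_of_ne hj, Units.val_one, OneMemClass.coe_one, sub_self, Valuation.map_zero]
      exact zero_le
  have hprod : ∀ i : Fin 2, Tendsto (fun c =>
      ∏ᶠ v : {v : HeightOneSpectrum (𝓞 F) // (p : 𝓞 F) ∈ v.asIdeal},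
        x (𝒰.ordDiamond v.2 (Pi.mulSingle i (û c v.1 v.2)))) atTop (𝓝 1) := by
    intro i
    simp_rw [finprod_eq_prod_of_fintype]
    have h := tendsto_finsetProd (Finset.univ : Finset {v : HeightOneSpectrum (𝓞 F) //
      (p : 𝓞 F) ∈ v.asIdeal}) fun v _ => hfactor i v
    rwa [Finset.prod_const_one] at h
  have hAt : Tendsto A atTop (𝓝 1) := hprod 1
  have hCt : Tendsto C atTop (𝓝 1) := hprod 0
  -- (2) `N(u_c)^{2-k} → 1`
  have hnorm : ∀ c, ((p : ℤ) ^ c) ∣ Algebra.norm ℤ (u c) - 1 := fun c => by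
    obtain ⟨w, hw⟩ := hdiv c
    have hu : u c = 1 + ((p : ℤ) ^ c) • w := by
      rw [zsmul_eq_mul, Int.cast_pow, Int.cast_natCast, ← hw]; ring
    rw [hu]
    exact dvd_norm_one_add_smul_sub_one _ _
  have hB₀ : Tendsto (fun c => ((Algebra.norm ℤ (u c) : ℤ) : PadicAlgCl p)) atTop (𝓝 1) := by
    refine tendsto_iff_norm_sub_tendsto_zero.2 (squeeze_zero (fun _ => norm_nonneg _) (fun c => ?_)
      (tendsto_pow_atTop_nhds_zero_of_lt_one (inv_nonneg.2 (Nat.cast_nonneg p))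
        (inv_lt_one_of_one_lt₀ (by exact_mod_cast (Fact.out : p.Prime).one_lt))))
    have hcast : ((Algebra.norm ℤ (u c) : ℤ) : PadicAlgCl p) - 1 =
        (((Algebra.norm ℤ (u c) - 1 : ℤ) : ℚ_[p]) : PadicAlgCl p) := by
      push_cast
      rfl
    rw [hcast, PadicAlgCl.norm_extends, inv_pow, ← zpow_natCast, ← zpow_neg]
    exact (Padic.norm_int_le_pow_iff_dvd _ c).2 (hnorm c)
  have hBt : Tendsto B atTop (𝓝 1) := by
    have h := hB₀.zpow₀ (2 - (k : ℤ)) (Or.inl one_ne_zero)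
    rwa [one_zpow] at h
  -- (3) `A c ≠ 0` (a product of images of units), so `A c / B c` is an `N`-th root of unity `→ 1`
  have hAne : ∀ c, A c ≠ 0 := fun c => by
    simp only [hA, finprod_eq_prod_of_fintype]
    refine Finset.prod_ne_zero_iff.2 fun v _ => IsUnit.ne_zero ?_
    rw [← ordDiamondHom_apply 𝒰 h𝒰 v.2]
    exact (Group.isUnit _).map _ |>.map x
  have hBne : ∀ c, B c ≠ 0 := fun c hc => by
    have h := (hpow c).1
    rw [hc, zero_pow hN.ne'] at h
    exact pow_ne_zero N (hAne c) h
  have hDt : Tendsto (fun c => A c / B c) atTop (𝓝 1) := by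
    have h := hAt.div hBt one_ne_zero
    rwa [div_one] at h
  have hDpow : ∀ c, (A c / B c) ^ N = 1 := fun c => by
    rw [div_pow, (hpow c).1, div_self (pow_ne_zero N (hBne c))]
  have hAB : ∀ᶠ c in atTop, A c = B c := by
    filter_upwards [eventually_eq_one_of_pow_eq_one hN hDpow hDt] with c hc
    rwa [div_eq_one_iff_eq (hBne c)] at hc
  have hC1 : ∀ᶠ c in atTop, C c = 1 :=
    eventually_eq_one_of_pow_eq_one hN (fun c => (hpow c).2) hCt
  obtain ⟨c, hc₁, hc₂⟩ := (hAB.and hC1).exists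
  exact hfail c hc₁ hc₂

end BigHeckeGLn.TameLevel

end Literature.NumberTheory.Automorphic
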